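import Literature.NumberTheory.EllipticCurves.PAdicOneVariableSeriesFamilyRelSupply
import Literature.NumberTheory.EllipticCurves.PAdicOneVariableNormCoherentUnitInduceMomentsOfCharacter
import Literature.NumberTheory.EllipticCurves.ProfiniteGroupDistributionCharacterContinuous
import Literature.NumberTheory.NumberFields.RayClassFieldAdicTowerAbsolute
import HarnessLib

/-!
# A multiplicative `χ : Γ_K → 𝕜` whose restriction to `Gal(K̄/K(𝔪))` is a power of the `v`-adic Artin character (read in `ℤ_p`) is
# tower-continuous for the `v`-ray class tower `Gal(K̄/K(𝔪 v^{n+1}))` of `Γ_K` (de Shalit II.4.14 (36)–(38): `ε = φ^kχ` on `𝒢`, `ε|_G = κ^k`)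

Topic `NumberTheory/EllipticCurves`; namespace `Literature.NumberTheory.EllipticCurves`.

De Shalit, *Iwasawa theory of elliptic curves with complex multiplication* (1987), II.4.14 (p. 71–72): the integrands of the two-variable
interpolation formula are `p`-adic characters `ε` of `𝒢 = Gal(K(𝔣p^∞)/K)` whose restriction to `G = Gal(K(𝔣p^∞)/K(𝔣))` is an explicit power
of the local character `κ` (II.4.7 (17), II.4.11 (29)); such an `ε` is continuous for the `𝔭`-tower `Gal(K(𝔣𝔭^∞)/K(𝔣𝔭^n))`.  In the tree the
two-variable integral formulas (`Summits/…/PrintCf2RubinValueTwoEllipticUnitsTwoVariable{Integral,Moments,MomentsArtin}`) carry EXACTLY these two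
hypotheses on `χ`: multiplicativity with the restriction identity `χ|_{Gal(K̄/K(𝔣))} = ((e_p κ_v)⁻¹)^k`, AND tower-continuity for
`absRayAdicTower h𝔣 v`.  THIS file proves that the first implies the second:

* ★ `isTowerContinuous_absRayAdicTower_of_restrict_eq_character_pow` — for `K` totally complex, `𝔣 ≠ 0`, `v ∤ 𝔣`, `w_𝔣 = 1`,
  `e_p : 𝒪_v ≃+* ℤ_p`, a multiplicative `χ : Γ_K → 𝕜` (`𝕜` a normed `ℚ_p`-algebra) with `χ(y) = cast(((e_p κ_v)⁻¹ y)^k)` on `Gal(K̄/K(𝔣))`: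
  `χ` is tower-continuous along `Gal(K̄/K(𝔣 v^{n+1}))` (`isTowerContinuous_of_mul_of_tendsto_one`: on `U_n ⊆ Gal(K̄/K(𝔣))` the character
  is `≡ 1 mod p^{n+1}`, `isTowerContinuous_padicIntCast_character_pow` on the subgroup).

Everything is a theorem; no named facts, no instances, no `sorry`.

## References

* [deShalit1987] E. de Shalit, *Iwasawa theory of elliptic curves with complex multiplication* (1987), II.4.14 (36)–(38) (p. 71–72),
  II.4.7 (17) (p. 60), I.3.1 (p. 16), I.3.3 (9) (p. 18).
-/

noncomputable section

open scoped Classical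

namespace Literature.NumberTheory.EllipticCurves

open NumberField IsDedekindDomain IsDedekindDomain.HeightOneSpectrum Field
open Literature.NumberTheory.GaloisRepresentations Literature.NumberTheory.NumberFields

variable {K : Type} [Field K] [NumberField K] [IsTotallyComplex K] {𝔣 : Ideal (𝓞 K)} {v : HeightOneSpectrum (𝓞 K)}
  (h𝔣 : 𝔣 ≠ ⊥) (hv : ¬ 𝔣 ≤ v.asIdeal) (hw : ∀ u : (𝓞 K)ˣ, (u : 𝓞 K) - 1 ∈ 𝔣 → u = 1)
  {p : ℕ} [Fact p.Prime] (e₂ : v.adicCompletionIntegers K ≃+* ℤ_[p])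
  {𝕜 : Type*} [NormedField 𝕜] [NormedAlgebra ℚ_[p] 𝕜]

/-- ★ **Tower-continuity from the restriction identity**: a multiplicative `χ : Γ_K → 𝕜` with `χ(y) = cast(((e_p κ_v)⁻¹ y)^k)` for every
`y ∈ Gal(K̄/K(𝔣))` is tower-continuous for `U_n = Gal(K̄/K(𝔣 v^{n+1}))`: for `u ∈ U_n` one has `u ∈ Gal(K̄/K(𝔣))` and `κ_v(u) ≡ 1 mod v^{n+1}`,
so `χ(u) = cast(((e_pκ_v u)⁻¹)^k) → 1` uniformly in `n` (`isTowerContinuous_padicIntCast_character_pow` on the subgroup, against `y = 1`), and a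
multiplicative function tending to `1` along the levels is tower-continuous (`isTowerContinuous_of_mul_of_tendsto_one`).
[cite: deShalit1987, II.4.14 (36)–(38) (p. 71–72), I.3.3 (9) (p. 18), I.3.1 (p. 16)] -/
theorem isTowerContinuous_absRayAdicTower_of_restrict_eq_character_pow {χ : absoluteGaloisGroup K → 𝕜}
    (hmul : ∀ x y, χ (x * y) = χ x * χ y) (k : ℕ)
    (hχG : ∀ y : ↥(absRestrictNormalHom (rayClassField K 𝔣)).ker, χ y =
      padicIntCast 𝕜 (((((Units.map (e₂ : v.adicCompletionIntegers K →+* ℤ_[p]).toMonoidHom).comp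
        (rayAdicCharacter h𝔣 hv hw))⁻¹) y : ℤ_[p]) ^ k)) :
    (absRayAdicTower (𝔪' := 𝔣) h𝔣 v).IsTowerContinuous χ := by
  refine SubgroupTower.isTowerContinuous_of_mul_of_tendsto_one _ hmul fun ε hε ↦ ?_
  -- continuity of `y ↦ cast(κ(y)^k)` on the subgroup, against `y = 1`
  have hcont := SubgroupTower.isTowerContinuous_padicIntCast_character_pow (𝒰 := rayAdicTower (𝔪 := 𝔣) h𝔣 v) (𝕜 := 𝕜)
    (κ := (((Units.map (e₂ : v.adicCompletionIntegers K →+* ℤ_[p]).toMonoidHom).comp (rayAdicCharacter h𝔣 hv hw))⁻¹))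
    (hU := mem_rayAdicTower_iff_inv h𝔣 h𝔣 hv hw e₂ le_rfl hv) k
  obtain ⟨N, hN⟩ := hcont ε hε
  refine ⟨N, fun n hn u hu ↦ ?_⟩
  have huH : u ∈ (absRestrictNormalHom (rayClassField K 𝔣)).ker := absRayAdicTower_U_le_ker h𝔣 v le_rfl n hu
  have huV : (⟨u, huH⟩ : ↥(absRestrictNormalHom (rayClassField K 𝔣)).ker) ∈ (rayAdicTower (𝔪 := 𝔣) h𝔣 v).U n :=
    (coe_mem_absRayAdicTower_U_iff h𝔣 v n ⟨u, huH⟩).mp hu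
  have hproj : (rayAdicTower (𝔪 := 𝔣) h𝔣 v).proj n ⟨u, huH⟩ = (rayAdicTower (𝔪 := 𝔣) h𝔣 v).proj n 1 := by
    rw [SubgroupTower.proj_eq_iff, mul_one]
    exact inv_mem huV
  have h := hN n hn ⟨u, huH⟩ 1 hproj
  have hu' : χ u = padicIntCast 𝕜 (((((Units.map (e₂ : v.adicCompletionIntegers K →+* ℤ_[p]).toMonoidHom).comp
      (rayAdicCharacter h𝔣 hv hw))⁻¹) ⟨u, huH⟩ : ℤ_[p]) ^ k) := hχG ⟨u, huH⟩
  rw [hu']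
  rw [dist_eq_norm] at h
  simpa only [MonoidHom.inv_apply, map_one, inv_one, Units.val_one, one_pow] using h

end Literature.NumberTheory.EllipticCurves

end
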